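import Mathlib
import Summits.KontsevichZagierPeriods.KontsevichZagierPeriods.Theses.SymplecticScissors
import Literature.NumberTheory.Transcendental.KZCalculusProofs
import Literature.NumberTheory.Transcendental.SemialgebraicMapsProofs
import Literature.NumberTheory.Transcendental.KZSemialgebraicComplex

/-!
# `VolumeForm` (stmt-KontsevichZagierPeriods-3814), line `Sketch` — stub `stub_oddBallCylinder`

The calibration move "odd balls are cylinders over even balls" in dimension `3`: for
representations `r` on the open unit ball `{p 0 ^ 2 + p 1 ^ 2 + p 2 ^ 2 < 1}` and `r'` on the
cylinder `{q 0 ^ 2 + q 1 ^ 2 < 1} × (−2/3, 2/3)`, both with integrand `1` on their domains,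
`[r] − [r']` is ONE change-of-variables generator (`KZ.changeOfVariablesRel`, rule (2) of
[Kontsevich–Zagier 2001, §1.2]). Witness
`Φ p = (p 0 / √(1 − p 2 ²), p 1 / √(1 − p 2 ²), p 2 − p 2 ³ / 3)`, with upper triangular
Jacobian `Φ' p = [[s⁻¹, 0, p 0 p 2 / s³], [0, s⁻¹, p 1 p 2 / s³], [0, 0, 1 − p 2 ²]]`,
`s = √(1 − p 2 ²)`, so `det Φ' = (1 − p 2 ²) / s² = 1` (Archimedes: `∫₋₁¹ (1 − z²) dz = 4/3`,
`vol B³ = π · 4/3`). The five fields: `Φ` is `ℚ`-semialgebraic (quotients by the square root of a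
polynomial, a polynomial), differentiable on the ball, injective (the cubic `z − z³/3` is strictly
increasing on `[−1, 1]`), onto the cylinder (intermediate value theorem for the cubic, explicit
inverse `(q 0 s, q 1 s, z)`), and `1 = 1 · |1|`.

Sources: M. Kontsevich, D. Zagier, *Periods* (2001), §1.2 rule (2); Archimedes, *On the Sphere and
Cylinder* I; the rest is folklore calculus.
-/

noncomputable section

open Set MeasureTheory MvPolynomial
open Literature.NumberTheory.Transcendental

namespace Summit.KontsevichZagierPeriods.SymplecticScissors.VolumeForm

/-- The cubic `z ↦ z − z³/3` is strictly increasing on `[−1, 1]`. [folklore] -/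
theorem oddBall_cubic_lt {y z : ℝ} (hy : -1 ≤ y) (hz : z ≤ 1) (hyz : y < z) :
    y - y ^ 3 / 3 < z - z ^ 3 / 3 := by
  have h3 : 0 < 3 - z ^ 2 - z * y - y ^ 2 := by
    nlinarith [mul_pos (sub_pos.2 hyz) (by linarith : (0 : ℝ) < 3 - z + y),
      mul_nonneg (sub_nonneg.2 hz) (by linarith : (0 : ℝ) ≤ 1 + y)]
  nlinarith [mul_pos (sub_pos.2 hyz) h3]

/-- The cubic `z ↦ z − z³/3` maps `(−1, 1)` into `(−2/3, 2/3)`. [folklore] -/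
theorem oddBall_cubic_mem {z : ℝ} (hz : -1 < z) (hz' : z < 1) :
    -(2 / 3 : ℝ) < z - z ^ 3 / 3 ∧ z - z ^ 3 / 3 < 2 / 3 := by
  constructor
  · have h := oddBall_cubic_lt le_rfl hz'.le hz
    norm_num at h
    linarith
  · have h := oddBall_cubic_lt hz.le le_rfl hz'
    norm_num at h
    linarith

/-- The cubic `z ↦ z − z³/3` is injective on `[−1, 1]`. [folklore] -/
theorem oddBall_cubic_inj {y z : ℝ} (hy : -1 ≤ y) (hy' : y ≤ 1) (hz : -1 ≤ z) (hz' : z ≤ 1)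
    (h : y - y ^ 3 / 3 = z - z ^ 3 / 3) : y = z := by
  rcases lt_trichotomy y z with hlt | heq | hgt
  · exact absurd h (oddBall_cubic_lt hy hz' hlt).ne
  · exact heq
  · exact absurd h (oddBall_cubic_lt hz hy' hgt).ne'

/-- The cubic `z ↦ z − z³/3` maps `(−1, 1)` onto `(−2/3, 2/3)` (intermediate value theorem).
[folklore] -/
theorem oddBall_cubic_surj {w : ℝ} (hw : -(2 / 3 : ℝ) < w) (hw' : w < 2 / 3) :
    ∃ z : ℝ, -1 < z ∧ z < 1 ∧ z - z ^ 3 / 3 = w := by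
  have hcont : ContinuousOn (fun z : ℝ => z - z ^ 3 / 3) (Icc (-1) 1) := by fun_prop
  have hmem : w ∈ Icc ((-1 : ℝ) - (-1) ^ 3 / 3) (1 - 1 ^ 3 / 3) := by
    constructor <;> norm_num <;> linarith
  obtain ⟨z, ⟨hz1, hz2⟩, hz⟩ := intermediate_value_Icc (by norm_num) hcont hmem
  refine ⟨z, lt_of_le_of_ne hz1 ?_, lt_of_le_of_ne hz2 ?_, hz⟩
  · rintro rfl
    norm_num at hz
    linarith
  · rintro rfl
    norm_num at hz
    linarith

/-- Derivative of `z ↦ (√(1 − z²))⁻¹` on `(−1, 1)`: `z / (√(1 − z²))³`. [folklore] -/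
theorem oddBall_hasDerivAt_invSqrt {z : ℝ} (hz : z ^ 2 < 1) :
    HasDerivAt (fun z : ℝ => (√(1 - z ^ 2))⁻¹) (z / √(1 - z ^ 2) ^ 3) z := by
  have hs : 0 < 1 - z ^ 2 := by linarith
  have hsq : √(1 - z ^ 2) ≠ 0 := Real.sqrt_ne_zero'.2 hs
  have h1 : HasDerivAt (fun z : ℝ => 1 - z ^ 2) (-(↑(2 : ℕ) * z ^ (2 - 1))) z :=
    (hasDerivAt_pow 2 z).const_sub 1
  have h2 := (h1.sqrt hs.ne').inv hsq
  refine h2.congr_deriv ?_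
  have hs2 : √(1 - z ^ 2) ^ 2 = 1 - z ^ 2 := Real.sq_sqrt hs.le
  field_simp
  push_cast
  ring

/-- Derivative of the coordinate `p ↦ p i / √(1 − p 2 ²)` of the flattening map at a point of the
ball: `v ↦ s⁻¹ v i + (p i p 2 / s³) v 2`, `s = √(1 − p 2 ²)`. [folklore] -/
theorem oddBall_hasFDerivAt_div (x : Fin 3 → ℝ) (i : Fin 3) (hx : x 2 ^ 2 < 1) :
    HasFDerivAt (fun p : Fin 3 → ℝ => p i / √(1 - p 2 ^ 2))
      ((√(1 - x 2 ^ 2))⁻¹ • ContinuousLinearMap.proj (R := ℝ) (φ := fun _ : Fin 3 => ℝ) i +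
        (x i * x 2 / √(1 - x 2 ^ 2) ^ 3) •
          ContinuousLinearMap.proj (R := ℝ) (φ := fun _ : Fin 3 => ℝ) 2) x := by
  have hi : HasFDerivAt (fun p : Fin 3 → ℝ => p i)
      (ContinuousLinearMap.proj (R := ℝ) (φ := fun _ : Fin 3 => ℝ) i) x := hasFDerivAt_apply i x
  have h2 : HasFDerivAt (fun p : Fin 3 → ℝ => p 2)
      (ContinuousLinearMap.proj (R := ℝ) (φ := fun _ : Fin 3 => ℝ) 2) x := hasFDerivAt_apply 2 x
  have hinv : HasFDerivAt (fun p : Fin 3 → ℝ => (√(1 - p 2 ^ 2))⁻¹)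
      ((x 2 / √(1 - x 2 ^ 2) ^ 3) • ContinuousLinearMap.proj (R := ℝ) (φ := fun _ : Fin 3 => ℝ) 2)
      x := by
    have h := (oddBall_hasDerivAt_invSqrt hx).comp_hasFDerivAt x h2
    exact h
  have hmul := hi.mul hinv
  have hfun : (fun p : Fin 3 → ℝ => p i / √(1 - p 2 ^ 2)) =
      (fun p : Fin 3 → ℝ => p i) * fun p : Fin 3 → ℝ => (√(1 - p 2 ^ 2))⁻¹ := by
    funext p
    simp [div_eq_mul_inv]
  rw [hfun]
  refine hmul.congr_fderiv ?_
  ext v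
  simp only [_root_.add_apply, _root_.smul_apply, ContinuousLinearMap.proj_apply, smul_eq_mul]
  ring

/-- Derivative of the third coordinate `p ↦ p 2 − p 2 ³ / 3` of the flattening map:
`v ↦ (1 − p 2 ²) v 2`. [folklore] -/
theorem oddBall_hasFDerivAt_thd (x : Fin 3 → ℝ) :
    HasFDerivAt (fun p : Fin 3 → ℝ => p 2 - p 2 ^ 3 / 3)
      ((1 - x 2 ^ 2) • ContinuousLinearMap.proj (R := ℝ) (φ := fun _ : Fin 3 => ℝ) 2) x := by
  have h2 : HasFDerivAt (fun p : Fin 3 → ℝ => p 2)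
      (ContinuousLinearMap.proj (R := ℝ) (φ := fun _ : Fin 3 => ℝ) 2) x := hasFDerivAt_apply 2 x
  have h1 : HasDerivAt (fun z : ℝ => z - z ^ 3 / 3) (1 - ↑(3 : ℕ) * x 2 ^ (3 - 1) / 3) (x 2) :=
    (hasDerivAt_id (x 2)).sub ((hasDerivAt_pow 3 (x 2)).div_const 3)
  have h := h1.comp_hasFDerivAt x h2
  refine h.congr_fderiv ?_
  ext v
  simp only [_root_.smul_apply, ContinuousLinearMap.proj_apply, smul_eq_mul]
  push_cast
  ring

/-- **Odd balls are cylinders over even balls** (stub `stub_oddBallCylinder` of the line `Sketch`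
for `VolumeForm`, stmt-KontsevichZagierPeriods-3814). For representations `r` on the open unit
ball of `ℝ³` and `r'` on the cylinder `{q 0 ^ 2 + q 1 ^ 2 < 1, −2/3 < q 2 < 2/3}`, both with
integrand `1` on their domains, `[r] − [r']` is one change-of-variables generator of the
Kontsevich–Zagier calculus, with witness
`Φ p = (p 0 / √(1 − p 2 ²), p 1 / √(1 − p 2 ²), p 2 − p 2 ³ / 3)` (`|det Φ'| = 1`).
[cite: KontsevichZagier2001, §1.2 rule (2)] -/
theorem stub_oddBallCylinder : ∀ (r r' : KZ.IntegralRep 3),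
    r.domain = {p | p 0 ^ 2 + p 1 ^ 2 + p 2 ^ 2 < 1} →
    r'.domain = {q | q 0 ^ 2 + q 1 ^ 2 < 1 ∧ -(2 / 3 : ℝ) < q 2 ∧ q 2 < 2 / 3} →
    (∀ p ∈ r.domain, r.integrand p = 1) → (∀ q ∈ r'.domain, r'.integrand q = 1) →
    KZ.of r - KZ.of r' ∈ KZ.changeOfVariablesRel := by
  intro r r' hr hr' hf hf'
  -- membership in the two domains, unfolded
  have memr : ∀ p, p ∈ r.domain ↔ p 0 ^ 2 + p 1 ^ 2 + p 2 ^ 2 < 1 := fun p => by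
    rw [hr]; rfl
  have memr' : ∀ q, q ∈ r'.domain ↔
      (q 0 ^ 2 + q 1 ^ 2 < 1 ∧ -(2 / 3 : ℝ) < q 2 ∧ q 2 < 2 / 3) := fun q => by
    rw [hr']; rfl
  -- on the ball the third coordinate lies in `(−1, 1)`
  have ball2 : ∀ p ∈ r.domain, p 2 ^ 2 < 1 := fun p hp => by
    have := (memr p).1 hp
    nlinarith [sq_nonneg (p 0), sq_nonneg (p 1)]
  -- the witness
  let Φ : (Fin 3 → ℝ) → (Fin 3 → ℝ) := fun p =>
    ![p 0 / √(1 - p 2 ^ 2), p 1 / √(1 - p 2 ^ 2), p 2 - p 2 ^ 3 / 3]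
  let Φ' : (Fin 3 → ℝ) → (Fin 3 → ℝ) →L[ℝ] (Fin 3 → ℝ) := fun x =>
    ContinuousLinearMap.pi
      ![(√(1 - x 2 ^ 2))⁻¹ • ContinuousLinearMap.proj (R := ℝ) (φ := fun _ : Fin 3 => ℝ) 0 +
          (x 0 * x 2 / √(1 - x 2 ^ 2) ^ 3) •
            ContinuousLinearMap.proj (R := ℝ) (φ := fun _ : Fin 3 => ℝ) 2,
        (√(1 - x 2 ^ 2))⁻¹ • ContinuousLinearMap.proj (R := ℝ) (φ := fun _ : Fin 3 => ℝ) 1 +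
          (x 1 * x 2 / √(1 - x 2 ^ 2) ^ 3) •
            ContinuousLinearMap.proj (R := ℝ) (φ := fun _ : Fin 3 => ℝ) 2,
        (1 - x 2 ^ 2) • ContinuousLinearMap.proj (R := ℝ) (φ := fun _ : Fin 3 => ℝ) 2]
  have hΦ0 : ∀ p, Φ p 0 = p 0 / √(1 - p 2 ^ 2) := fun p => rfl
  have hΦ1 : ∀ p, Φ p 1 = p 1 / √(1 - p 2 ^ 2) := fun p => rfl
  have hΦ2 : ∀ p, Φ p 2 = p 2 - p 2 ^ 3 / 3 := fun p => rfl
  -- the Jacobian determinant (upper triangular)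
  have hdet : ∀ x : Fin 3 → ℝ, x 2 ^ 2 < 1 → (Φ' x).det = 1 := by
    intro x hx
    have hs : 0 < 1 - x 2 ^ 2 := by linarith
    have hsq : √(1 - x 2 ^ 2) ≠ 0 := Real.sqrt_ne_zero'.2 hs
    have hs2 : √(1 - x 2 ^ 2) ^ 2 = 1 - x 2 ^ 2 := Real.sq_sqrt hs.le
    simp only [ContinuousLinearMap.det]
    rw [← LinearMap.det_toMatrix', Matrix.det_fin_three]
    simp [Φ', LinearMap.toMatrix'_apply]
    field_simp
    rw [hs2]
  -- Φ maps the ball into the cylinder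
  have hmaps : ∀ p ∈ r.domain, Φ p ∈ r'.domain := by
    intro p hp
    have hpr := (memr p).1 hp
    have h2 := ball2 p hp
    have hs : 0 < 1 - p 2 ^ 2 := by linarith
    have hz : -1 < p 2 ∧ p 2 < 1 := abs_lt.1 ((sq_lt_one_iff_abs_lt_one _).1 h2)
    rw [memr', hΦ0, hΦ1, hΦ2]
    refine ⟨?_, oddBall_cubic_mem hz.1 hz.2⟩
    rw [div_pow, div_pow, Real.sq_sqrt hs.le, ← add_div, div_lt_one hs]
    linarith
  -- Φ is onto the cylinder: explicit inverse `(q 0 s, q 1 s, z)`, `z − z³/3 = q 2`, `s = √(1 − z²)`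
  have hsurj : ∀ q ∈ r'.domain, ∃ p ∈ r.domain, Φ p = q := by
    intro q hq
    obtain ⟨hq01, hq2, hq2'⟩ := (memr' q).1 hq
    obtain ⟨z, hz1, hz2, hz⟩ := oddBall_cubic_surj hq2 hq2'
    have hs : 0 < 1 - z ^ 2 := by nlinarith
    set s : ℝ := √(1 - z ^ 2) with hs_def
    have hspos : 0 < s := Real.sqrt_pos.2 hs
    have hs2 : s ^ 2 = 1 - z ^ 2 := Real.sq_sqrt hs.le
    refine ⟨![q 0 * s, q 1 * s, z], ?_, ?_⟩
    · rw [memr]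
      simp only [Matrix.cons_val_zero, Matrix.cons_val_one, Matrix.cons_val_two,
        Matrix.head_cons, Matrix.tail_cons]
      rw [mul_pow, mul_pow]
      nlinarith [mul_lt_mul_of_pos_right hq01 hs]
    · have hz2' : (![q 0 * s, q 1 * s, z] : Fin 3 → ℝ) 2 = z := rfl
      funext i
      fin_cases i
      · show Φ ![q 0 * s, q 1 * s, z] 0 = q 0
        rw [hΦ0, hz2', ← hs_def]
        simp only [Matrix.cons_val_zero]
        field_simp
      · show Φ ![q 0 * s, q 1 * s, z] 1 = q 1
        rw [hΦ1, hz2', ← hs_def]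
        simp only [Matrix.cons_val_one, Matrix.cons_val_zero]
        field_simp
      · show Φ ![q 0 * s, q 1 * s, z] 2 = q 2
        rw [hΦ2, hz2', hz]
  refine ⟨3, r, r', Φ, Φ', ?_, ?_, ?_, ?_, ?_, rfl⟩
  · -- `Φ` is `ℚ`-semialgebraic on the ball
    have hsqrt : IsSemialgebraicFunOn ℚ r.domain (fun p : Fin 3 → ℝ => √(1 - p 2 ^ 2)) := by
      refine (IsSemialgebraicFunOn.sqrt_holds (isSemialgebraicFunOn_aeval
        r.isSemialgebraic_domain (1 - X 2 ^ 2 : MvPolynomial (Fin 3) ℚ))).congr ?_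
      intro p _
      simp
    have hne : ∀ p ∈ r.domain, √(1 - p 2 ^ 2) ≠ 0 := fun p hp =>
      Real.sqrt_ne_zero'.2 (by linarith [ball2 p hp])
    refine IsSemialgebraicMapOn.of_forall r.isSemialgebraic_domain fun j => ?_
    fin_cases j
    · refine ((isSemialgebraicFunOn_aeval r.isSemialgebraic_domain
        (X 0 : MvPolynomial (Fin 3) ℚ)).div hsqrt hne).congr ?_
      intro p _
      simp [hΦ0]
    · refine ((isSemialgebraicFunOn_aeval r.isSemialgebraic_domain
        (X 1 : MvPolynomial (Fin 3) ℚ)).div hsqrt hne).congr ?_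
      intro p _
      simp [hΦ1]
    · refine (isSemialgebraicFunOn_aeval r.isSemialgebraic_domain
        (X 2 - C (1 / 3 : ℚ) * X 2 ^ 3 : MvPolynomial (Fin 3) ℚ)).congr ?_
      intro p _
      simp [hΦ2]
      ring
  · -- differentiability within the ball
    intro x hx
    have h2 := ball2 x hx
    refine HasFDerivAt.hasFDerivWithinAt (hasFDerivAt_pi'' fun i => ?_)
    fin_cases i
    · rw [ContinuousLinearMap.proj_pi]
      exact oddBall_hasFDerivAt_div x 0 h2
    · rw [ContinuousLinearMap.proj_pi]
      exact oddBall_hasFDerivAt_div x 1 h2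
    · rw [ContinuousLinearMap.proj_pi]
      exact oddBall_hasFDerivAt_thd x
  · -- injectivity on the ball
    intro p hp q hq hpq
    have hp2 := abs_lt.1 ((sq_lt_one_iff_abs_lt_one _).1 (ball2 p hp))
    have hq2 := abs_lt.1 ((sq_lt_one_iff_abs_lt_one _).1 (ball2 q hq))
    have e0 : p 0 / √(1 - p 2 ^ 2) = q 0 / √(1 - q 2 ^ 2) := by rw [← hΦ0, ← hΦ0, hpq]
    have e1 : p 1 / √(1 - p 2 ^ 2) = q 1 / √(1 - q 2 ^ 2) := by rw [← hΦ1, ← hΦ1, hpq]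
    have e2 : p 2 - p 2 ^ 3 / 3 = q 2 - q 2 ^ 3 / 3 := by rw [← hΦ2, ← hΦ2, hpq]
    have h2 : p 2 = q 2 := oddBall_cubic_inj hp2.1.le hp2.2.le hq2.1.le hq2.2.le e2
    have hne : √(1 - q 2 ^ 2) ≠ 0 := Real.sqrt_ne_zero'.2 (by linarith [ball2 q hq])
    rw [h2, div_left_inj' hne] at e0 e1
    funext i
    fin_cases i
    · exact e0
    · exact e1
    · exact h2
  · -- the image is the cylinder
    refine Subset.antisymm (fun q hq => ?_) ?_
    · obtain ⟨p, hp, hpq⟩ := hsurj q hq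
      exact ⟨p, hp, hpq⟩
    · rintro _ ⟨p, hp, rfl⟩
      exact hmaps p hp
  · -- the integrands: `1 = 1 · |1|`
    intro x hx
    rw [hf x hx, hf' _ (hmaps x hx), hdet x (ball2 x hx)]
    norm_num

end Summit.KontsevichZagierPeriods.SymplecticScissors.VolumeForm

end
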